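import Summits.MatrixMultiplication.MatrixMultiplication.Theorems.AbelianSTPPCensusTDStatDefs

/-!
# T_D static certificate, orders `477 … 627` (theory's t*-indexed linear checker at `τ = 247/100`): kernel evaluation, the shape checks, volumes `1 … 627`

Cell mm-stpp (rung F-M1), tier T_D = «beat `2.47`»; checker in `AbelianSTPPCensusTDStatDefs.lean`, table in `AbelianSTPPCensusTDStatData.lean`
(pattern: theory g12's `AbelianSTPPCensusTAStatCCk*.lean`).  `decide` with kernel reduction (standard axioms; no `native_decide`), `Elab.async false`;
consumed by `TDStat.checkV_sound` / `TDStat.domV_sound` in the leaf `AbelianSTPPCensusLeafTD627Closed.lean`.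
WHAT THIS IS NOT: arithmetic on shape lists only; no statement about STPP families or `ω`.
-/

set_option linter.dupNamespace false
set_option autoImplicit false
set_option Elab.async false

namespace Summit.MatrixMultiplication.MatrixMultiplication.Theorems.TDStat

set_option maxHeartbeats 0 in
/-- Check chunk: every sorted candidate shape of the volumes `1 … 287` passes `checkShape` (27528 (shape, bucket) checks). [original] -/
theorem ck1 : TDStat.checkV 287 1 = true := by decide +kernel

set_option maxHeartbeats 0 in
/-- Check chunk: every sorted candidate shape of the volumes `288 … 433` passes `checkShape` (27883 (shape, bucket) checks). [original] -/
theorem ck288 : TDStat.checkV 146 288 = true := by decide +kernel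

set_option maxHeartbeats 0 in
/-- Check chunk: every sorted candidate shape of the volumes `434 … 627` passes `checkShape` (25270 (shape, bucket) checks). [original] -/
theorem ck434 : TDStat.checkV 194 434 = true := by decide +kernel

end Summit.MatrixMultiplication.MatrixMultiplication.Theorems.TDStat
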